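/-
Copyright (c) 2026 the pub-hodgecm-mathlib formalisation cell (harness21).  Prover seat hodgecm-mathlib-B-p04 (g61), req618 STAGE 1a «FOUR-FRAME» squad (director s1808;
LEAD directive v1.1 d3f1616d0136e728 D7 «B-p04 — dictionary support»): the unit orbital integral of a GENERAL compact open subgroup (no `ν(K) = 1` normalisation) as
`ν(K)` times the fixed-coset count — the measure-theoretic half of the census Prop (D-G) `AnchorCountDictionary` (its «one constant `C_t`» is `ν(K_t)`).  2026-09-03.
-/
import Literature.NumberTheory.Automorphic.UnitaryUnitOrbitalIntegralFixedPoints   -- ★ `classOrbitalIntegral_indicator_complex_eq_ofReal`; brings ★ `UnitOrbitalIntegralFixedPoints` (`orbitalIntegral_indicator_quotientMeasure_eq_card_mul`, `finite_fixedBy_quotient_of_isClosed`)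
import HarnessLib

/-!
# The unit orbital integral of a compact open `K` at an elliptic class, canonical measures: `Φ(⟦γ⟧, 1_K; m) = ν(K) · #Fix_γ(G ⧸ K)`
(Laumon 1996 Lemma (5.3.2); Kottwitz 1986 §3; Rogawski 1990 §4.9 p. 54)

Topic `NumberTheory/Automorphic`; namespace `Literature.NumberTheory.Automorphic`.  THEOREMS ONLY (no definition, no instance, no notation, no named fact, no `sorry`);
generic locally compact group `G`.  Cell `pub/hodgecm-mathlib` (D-0151), crux H413 = `stmt-HodgeConjecture-24833`, organ (D-RAM) `stub_DyRamCore`, «FOUR-FRAME» road, unit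
(ii-G): the census dictionary Prop (D-G) `AnchorCountDictionary t` (GATE 1a-1, F0P3a-p01 (g30)) reads `Φ(⟦γ⟧, 1_{K_t}) = C_t · n_t(Γ_b)` with ONE constant `C_t` per
anchor subgroup `K_t` = the stabiliser of a type-`t` vertex — NOT the integral level, so `ν(K_t) ≠ 1` in general.  ★ `classOrbitalIntegral_indicator_eq_card_fixedBy`
(F0P3a-p04) is the `ν(K) = 1` reading; THIS FILE removes that normalisation and exhibits the constant: for a family `m` CANONICAL for `(P, ν)` (★ `IsCanonical`: at a `P`-class
the member is `ν ∕ t`, `t` the inversion-invariant Haar measure of mass one on the compact core of the centraliser), `P` conjugation-invariant with `P γ`, `C_G(γ)` COMPACT,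
the class of `γ` closed and `K` compact open, **`Φ(⟦γ⟧, 1_K; m) = ν(K).toReal · Nat.card Fix_γ(G ⧸ K)`** (§1, real and complex currencies) — ★
`orbitalIntegral_indicator_quotientMeasure_eq_card_mul` (the `ν(K) ∕ t(C)` form) at `t(C) = 1`.

* §1 **`classOrbitalIntegral_indicator_eq_measureReal_mul_card_fixedBy`** (`ℝ`), **`classOrbitalIntegral_indicator_complex_eq_measureReal_mul_natCard_fixedBy`** (`ℂ`).

NOT HERE: the lattice dictionary `#Fix_γ(G ⧸ K_t) = fixedVertexCount …` (★ `UnitaryThreeFourFrameFixedCosetDictionary`, this seat), the CM-place instantiation.  HONEST LABEL: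
HC_CM is proved only modulo the 7 printed citations (2 remaining named inputs: hLiu418 = stmt-HodgeConjecture-24832, h413 = stmt-HodgeConjecture-24833) until rung 0 closes;
this file is measure bookkeeping and moves nothing.
-/

noncomputable section

open MeasureTheory Measure Topology Filter Set
open scoped ENNReal NNReal Pointwise

namespace Literature.NumberTheory.Automorphic

open Literature.MeasureTheory.Group

/-! ## §1 The class reading with the constant `ν(K)` -/

section Scaled

variable {G : Type*} [Group G] [TopologicalSpace G] [IsTopologicalGroup G] [LocallyCompactSpace G]
  [SecondCountableTopology G] [T2Space G] [MeasurableSpace G] [BorelSpace G]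
  [∀ γ : G, MeasurableSpace (G ⧸ Subgroup.centralizer ({γ} : Set G))]
  [∀ γ : G, BorelSpace (G ⧸ Subgroup.centralizer ({γ} : Set G))]

/-- **`classOrbitalIntegral m 1_K ⟦γ⟧ = ν(K).toReal · Nat.card Fix_γ(G ⧸ K)`** for a family `m` CANONICAL for `(P, ν)`, `P` conjugation-invariant with `P γ`, `C_G(γ)` COMPACT, the
class of `γ` closed, `K` compact open — the unit orbital integral of a GENERAL compact open subgroup as a fixed-coset count with the constant `ν(K)` (no `ν(K) = 1`).
[cite: Laumon1995, Lemma (5.3.2) p. 136] [cite: Rogawski1990, §4.9 p. 54, Prop. 4.9.1 (b) p. 55] [cite: Kottwitz1986, §3] -/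
theorem classOrbitalIntegral_indicator_eq_measureReal_mul_card_fixedBy {P : G → Prop} (hP : ∀ g x : G, P g → P (x * g * x⁻¹))
    {ν : Measure G} [ν.IsHaarMeasure] [ν.IsMulRightInvariant] {m : OrbitalMeasureFamily G} (hm : m.IsCanonical P ν)
    {γ : G} (hγ : P γ) [CompactSpace (Subgroup.centralizer ({γ} : Set G))] (K : Subgroup G) (hK : IsOpen (K : Set G))
    (hKc : IsCompact (K : Set G)) (hO : IsClosed {g | ∃ y : G, y * γ * y⁻¹ = g}) :
    classOrbitalIntegral m ((K : Set G).indicator (1 : G → ℝ)) (ConjClasses.mk γ) =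
      (ν K).toReal * (Nat.card (MulAction.fixedBy (G ⧸ K) γ) : ℝ) := by
  haveI : BorelSpace (Subgroup.centralizer ({γ} : Set G)) := Subtype.borelSpace _
  let K₀ : TopologicalSpace.PositiveCompacts (Subgroup.centralizer ({γ} : Set G)) :=
    ⟨⟨Set.univ, isCompact_univ⟩, by rw [interior_univ]; exact univ_nonempty⟩
  haveI : (haarMeasure K₀).IsInvInvariant := isInvInvariant_of_compactSpace _
  have h1 : haarMeasure K₀ Set.univ = 1 := haarMeasure_self
  have hcore : haarMeasure K₀ (compactCore (Subgroup.centralizer ({γ} : Set G))) = 1 := by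
    rw [compactCore_eq_univ]; exact h1
  haveI : IsClosed ((Subgroup.centralizer ({γ} : Set G) : Subgroup G) : Set G) := isClosed_coe_centralizer_singleton γ
  rw [hm.classOrbitalIntegral_mk_eq_orbitalIntegral' hP hγ (haarMeasure K₀) hcore,
    orbitalIntegral_indicator_quotientMeasure_eq_card_mul γ K (haarMeasure K₀) ν hK
      (finite_fixedBy_quotient_of_isClosed γ K hO hK hKc), h1, div_one, mul_comm]

/-- **`Φ(⟦γ⟧, 1_K; m) = ν(K).toReal · #Fix_γ(G ⧸ K)` in the letters' `ℂ` currency** (`1_K : G → ℂ`), same hypotheses.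
[cite: Laumon1995, Lemma (5.3.2) p. 136] [cite: Rogawski1990, §4.9 Prop. 4.9.1 (b) p. 55] [cite: Kottwitz1986, §3] -/
theorem classOrbitalIntegral_indicator_complex_eq_measureReal_mul_natCard_fixedBy {P : G → Prop} (hP : ∀ g x : G, P g → P (x * g * x⁻¹))
    {ν : Measure G} [ν.IsHaarMeasure] [ν.IsMulRightInvariant] {m : OrbitalMeasureFamily G} (hm : m.IsCanonical P ν)
    {γ : G} (hγ : P γ) [CompactSpace (Subgroup.centralizer ({γ} : Set G))] (K : Subgroup G) (hK : IsOpen (K : Set G))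
    (hKc : IsCompact (K : Set G)) (hO : IsClosed {g | ∃ y : G, y * γ * y⁻¹ = g}) :
    classOrbitalIntegral m ((K : Set G).indicator fun _ => (1 : ℂ)) (ConjClasses.mk γ) =
      ((ν K).toReal : ℂ) * (Nat.card (MulAction.fixedBy (G ⧸ K) γ) : ℂ) := by
  rw [classOrbitalIntegral_indicator_complex_eq_ofReal, classOrbitalIntegral_indicator_eq_measureReal_mul_card_fixedBy hP hm hγ K hK hKc hO,
    Complex.ofReal_mul, Complex.ofReal_natCast]

end Scaled

end Literature.NumberTheory.Automorphic

end
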